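import Mathlib
import HarnessLib
import Literature.Analysis.FluidPDE.SpaceTimeCalculus
import Summits.NavierStokesRegularity.NavierStokesRegularity.Theorems.PoloidalWindowDoorPoloidalWindowRigidityZShockWaveLocalEnergy
import Summits.NavierStokesRegularity.NavierStokesRegularity.Theorems.PoloidalWindowDoorPoloidalWindowRigidityZShockLocalEnergyLocal

/-!
# Crux K2 `PoloidalWindowRigidity` (stmt-NavierStokesRegularity-19708), line `z_shock` — R3 infrastructure: the LOCAL ENERGY
# INEQUALITY FOR `w_ss = div(γ(w)∇w)` WITH THE EQUATION ASSUMED ON THE SOLID CONE ONLY (companion of `…ZShockLocalEnergyLocal`)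

`--supports stmt-NavierStokesRegularity-19708 --as helper` (leafhand-ns-poloidalwindowdoor-3 g6, cell decomp-ns, 2026-08-31).
**No stub and no summit is closed by this file; Navier–Stokes regularity is NOT proved here (rung 0).**

WHY THIS FILE.  `…ZShockWaveLocalEnergy` (hand 3-g5) proves the local energy inequality and the domain of dependence for the autonomous
height-evolution `∂ₛ∂ₛw = Σᵢ ∂ᵢ(γ(w)∂ᵢw)` of rung R3 with the equation and the bounds `0 ≤ γ(w) ≤ c²`, `|γ'(w)∂ₛw| ≤ Kγ(w)` assumed at
EVERY point.  On the deciding stub's data (`…ZShockHeightEvolution.heightEvolution_of_class_autonomy` + the slice-typing dictionary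
`…ZShockSliceTyping.slice_wave_pde_field`) the equation holds only on an open subset of the slice (a non-degenerate component `Ω`, where
the slope function lives) and hyperbolicity only on the window.  This file (3-g5's packaging item «localised part 2», wave half; the
abstract half is `…ZShockLocalEnergyLocal`) removes the global assumptions:

* `waveEnergy_balance_at` — the POINTWISE wave-energy balance: the equation at ONE point `(s, y)` gives the balance law
  `∂ₛ[½(∂ₛw)² + ½γ(w)|∇w|²] + Σᵢ ∂ᵢ[−γ(w)∂ₛw∂ᵢw] = ½γ'(w)∂ₛw|∇w|²` at that point (the proof of
  `…ZShockWaveLocalEnergy.waveEnergy_balance`, which used the equation only there);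
* `waveEnergy_closedBall_le_exp_mul_local` — the local energy inequality
  `∫_{|y|≤ρ} e(t) ≤ exp(K(t−t₀)) ∫_{|y| ≤ √(1+ρ²)+c(t−t₀)+1} e(t₀)` with the equation and the bounds on `γ` assumed ONLY at the points
  `(s, y)` with `t₀ ≤ s ≤ t`, `‖y‖ ≤ √(1+ρ²) + c(t − s) + 1` (the truncated solid backward cone, widened by the unit transition shell);
* `static_of_static_data_local` — domain of dependence under the same cone-local hypotheses.

So the energy files now apply to the stub's objects on every solid cone inside a strictly hyperbolic sub-region of `Ω` (fields globally
smooth, as they are: the slice is entire real-analytic).  HONEST: bookkeeping-grade; in the real-analytic class the static corollary is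
superseded by analytic continuation, and the inequality proves no rigidity (its cubic source is the THICK term).  presearch: textbook energy
method (Evans §2.4.3; [corpus:book:alinhac2009 pp.44–46]). [folklore]
-/

noncomputable section

namespace Summit.NavierStokesRegularity.NavierStokesRegularity.Theorems.PoloidalWindowDoorPoloidalWindowRigidityZShockWaveLocalEnergyLocal

-- the problem directory repeats the summit name (`NavierStokesRegularity/NavierStokesRegularity`)
set_option linter.dupNamespace false

open MeasureTheory Set Filter Topology Function Metric
open scoped ContDiff
open Literature.Analysis.FluidPDE
open Summit.NavierStokesRegularity.NavierStokesRegularity.Theorems.PoloidalWindowDoorPoloidalWindowRigidityZShockLocalEnergyCutoff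
open Summit.NavierStokesRegularity.NavierStokesRegularity.Theorems.PoloidalWindowDoorPoloidalWindowRigidityZShockLocalEnergy
open Summit.NavierStokesRegularity.NavierStokesRegularity.Theorems.PoloidalWindowDoorPoloidalWindowRigidityZShockWaveLocalEnergy
open Summit.NavierStokesRegularity.NavierStokesRegularity.Theorems.PoloidalWindowDoorPoloidalWindowRigidityZShockLocalEnergyLocal

/-! ### The wave energy of `w_ss = div(γ(w)∇w)`: pointwise balance and cone-local energy inequality -/

section Wave

variable {n : ℕ} {w : ℝ → EuclideanSpace ℝ (Fin n) → ℝ} {γ : ℝ → ℝ}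

/-- **The wave-energy balance law, POINTWISE.**  For jointly smooth `w` and smooth `γ`, the equation
`∂ₛ∂ₛw = Σᵢ ∂ᵢ(γ(w) ∂ᵢw)` AT THE POINT `(s, y)` gives the balance law
`∂ₛ[½(∂ₛw)² + ½γ(w)|∇w|²] + Σᵢ ∂ᵢ[−γ(w) ∂ₛw ∂ᵢw] = ½γ'(w) ∂ₛw |∇w|²` at `(s, y)` (the proof of
`…ZShockWaveLocalEnergy.waveEnergy_balance`, which used the equation only at the point). [folklore] -/
theorem waveEnergy_balance_at (hw : ContDiff ℝ ∞ (uncurry w)) (hγ : ContDiff ℝ ∞ γ) {s : ℝ} {y : EuclideanSpace ℝ (Fin n)}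
    (hpde : deriv (fun s' => deriv (fun s'' => w s'' y) s') s =
      ∑ i, fderiv ℝ (fun y' => γ (w s y') * fderiv ℝ (w s) y' (EuclideanSpace.single i 1)) y
        (EuclideanSpace.single i 1)) :
    deriv (fun s' => (1 / 2) * deriv (fun s'' => w s'' y) s' ^ 2 +
        (1 / 2) * γ (w s' y) * ∑ i, fderiv ℝ (w s') y (EuclideanSpace.single i 1) ^ 2) s +
      ∑ i, fderiv ℝ (fun y' => -(γ (w s y') * deriv (fun s'' => w s'' y') s *
          fderiv ℝ (w s) y' (EuclideanSpace.single i 1))) y (EuclideanSpace.single i 1) =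
      (1 / 2) * deriv γ (w s y) * deriv (fun s'' => w s'' y) s *
        ∑ i, fderiv ℝ (w s) y (EuclideanSpace.single i 1) ^ 2 := by
  have hST : IsSmoothSpaceTimeOn univ w := isSmoothSpaceTimeOn_univ hw
  have hds : ContDiff ℝ ∞ (uncurry fun s y => deriv (fun s' => w s' y) s) := contDiff_uncurry_deriv hw
  have hdi : ∀ i : Fin n, ContDiff ℝ ∞ (uncurry fun s y => fderiv ℝ (w s) y (EuclideanSpace.single i 1)) :=
    fun i => contDiff_uncurry_fderiv_apply hw _
  have hγd : Differentiable ℝ γ := hγ.differentiable (by simp)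
  have hl0 : HasDerivAt (fun s' => w s' y) (deriv (fun s'' => w s'' y) s) s :=
    ((contDiff_line hw y).differentiable (by simp) s).hasDerivAt
  have hl1 : HasDerivAt (fun s' => deriv (fun s'' => w s'' y) s')
      (deriv (fun s' => deriv (fun s'' => w s'' y) s') s) s :=
    ((contDiff_line hds y).differentiable (by simp) s).hasDerivAt
  have hl2 : ∀ i : Fin n, HasDerivAt (fun s' => fderiv ℝ (w s') y (EuclideanSpace.single i 1))
      (fderiv ℝ (fun y' => deriv (fun s'' => w s'' y') s) y (EuclideanSpace.single i 1)) s :=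
    fun i => hST.hasDerivAt_fderiv_slice isOpen_univ (mem_univ s) y (EuclideanSpace.single i 1)
  have hl3 : HasDerivAt (fun s' => γ (w s' y)) (deriv γ (w s y) * deriv (fun s'' => w s'' y) s) s :=
    (hγd (w s y)).hasDerivAt.comp s hl0
  have hE : HasDerivAt (fun s' => (1 / 2) * deriv (fun s'' => w s'' y) s' ^ 2 +
        (1 / 2) * γ (w s' y) * ∑ i, fderiv ℝ (w s') y (EuclideanSpace.single i 1) ^ 2)
      ((1 / 2) * (2 * deriv (fun s'' => w s'' y) s * deriv (fun s' => deriv (fun s'' => w s'' y) s') s) +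
        ((1 / 2) * (deriv γ (w s y) * deriv (fun s'' => w s'' y) s) *
            ∑ i, fderiv ℝ (w s) y (EuclideanSpace.single i 1) ^ 2 +
          (1 / 2) * γ (w s y) * ∑ i, 2 * fderiv ℝ (w s) y (EuclideanSpace.single i 1) *
            fderiv ℝ (fun y' => deriv (fun s'' => w s'' y') s) y (EuclideanSpace.single i 1))) s := by
    have hsq : HasDerivAt (fun s' => deriv (fun s'' => w s'' y) s' ^ 2)
        (2 * deriv (fun s'' => w s'' y) s * deriv (fun s' => deriv (fun s'' => w s'' y) s') s) s := by
      have := hl1.fun_pow 2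
      simpa using this
    have hsum : HasDerivAt (fun s' => ∑ i, fderiv ℝ (w s') y (EuclideanSpace.single i 1) ^ 2)
        (∑ i, 2 * fderiv ℝ (w s) y (EuclideanSpace.single i 1) *
          fderiv ℝ (fun y' => deriv (fun s'' => w s'' y') s) y (EuclideanSpace.single i 1)) s := by
      have := HasDerivAt.fun_sum (u := Finset.univ) fun i _ => (hl2 i).fun_pow 2
      simpa using this
    exact (hsq.const_mul (1 / 2)).fun_add ((hl3.const_mul (1 / 2)).fun_mul hsum)
  have hws : ContDiff ℝ ∞ (w s) := contDiff_slice hw s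
  have hdss : ContDiff ℝ ∞ fun y' => deriv (fun s'' => w s'' y') s := contDiff_slice hds s
  have hdis : ∀ i : Fin n, ContDiff ℝ ∞ fun y' => fderiv ℝ (w s) y' (EuclideanSpace.single i 1) :=
    fun i => contDiff_slice (hdi i) s
  have hm0 : HasFDerivAt (w s) (fderiv ℝ (w s) y) y := (hws.differentiable (by simp) y).hasFDerivAt
  have hm1 : HasFDerivAt (fun y' => γ (w s y')) (deriv γ (w s y) • fderiv ℝ (w s) y) y :=
    (hγd (w s y)).hasDerivAt.comp_hasFDerivAt y hm0
  have hm2 : HasFDerivAt (fun y' => deriv (fun s'' => w s'' y') s)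
      (fderiv ℝ (fun y' => deriv (fun s'' => w s'' y') s) y) y := (hdss.differentiable (by simp) y).hasFDerivAt
  have hm3 : ∀ i : Fin n, HasFDerivAt (fun y' => fderiv ℝ (w s) y' (EuclideanSpace.single i 1))
      (fderiv ℝ (fun y' => fderiv ℝ (w s) y' (EuclideanSpace.single i 1)) y) y :=
    fun i => ((hdis i).differentiable (by simp) y).hasFDerivAt
  have hP : ∀ i : Fin n, fderiv ℝ (fun y' => γ (w s y') * fderiv ℝ (w s) y' (EuclideanSpace.single i 1)) y
      (EuclideanSpace.single i 1) =
      deriv γ (w s y) * fderiv ℝ (w s) y (EuclideanSpace.single i 1) *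
          fderiv ℝ (w s) y (EuclideanSpace.single i 1) +
        γ (w s y) * fderiv ℝ (fun y' => fderiv ℝ (w s) y' (EuclideanSpace.single i 1)) y
          (EuclideanSpace.single i 1) := by
    intro i
    rw [(hm1.fun_mul (hm3 i)).fderiv]
    simp only [_root_.add_apply, _root_.smul_apply, smul_eq_mul]
    ring
  have hF : ∀ i : Fin n, fderiv ℝ (fun y' => -(γ (w s y') * deriv (fun s'' => w s'' y') s *
      fderiv ℝ (w s) y' (EuclideanSpace.single i 1))) y (EuclideanSpace.single i 1) =
      -((deriv γ (w s y) * fderiv ℝ (w s) y (EuclideanSpace.single i 1) * deriv (fun s'' => w s'' y) s +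
          γ (w s y) * fderiv ℝ (fun y' => deriv (fun s'' => w s'' y') s) y (EuclideanSpace.single i 1)) *
          fderiv ℝ (w s) y (EuclideanSpace.single i 1) +
        γ (w s y) * deriv (fun s'' => w s'' y) s *
          fderiv ℝ (fun y' => fderiv ℝ (w s) y' (EuclideanSpace.single i 1)) y (EuclideanSpace.single i 1)) := by
    intro i
    rw [((hm1.fun_mul hm2).fun_mul (hm3 i)).fun_neg.fderiv]
    simp only [_root_.neg_apply, _root_.add_apply, _root_.smul_apply, smul_eq_mul]
    ring
  rw [hE.deriv, Finset.sum_congr rfl fun i _ => hF i, hpde, Finset.sum_congr rfl fun i _ => hP i]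
  have hsum : ∑ i : Fin n, (deriv (fun s'' => w s'' y) s *
          (deriv γ (w s y) * fderiv ℝ (w s) y (EuclideanSpace.single i 1) *
              fderiv ℝ (w s) y (EuclideanSpace.single i 1) +
            γ (w s y) * fderiv ℝ (fun y' => fderiv ℝ (w s) y' (EuclideanSpace.single i 1)) y
              (EuclideanSpace.single i 1)) +
        (1 / 2) * γ (w s y) * (2 * fderiv ℝ (w s) y (EuclideanSpace.single i 1) *
            fderiv ℝ (fun y' => deriv (fun s'' => w s'' y') s) y (EuclideanSpace.single i 1)) +
        -((deriv γ (w s y) * fderiv ℝ (w s) y (EuclideanSpace.single i 1) * deriv (fun s'' => w s'' y) s +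
            γ (w s y) * fderiv ℝ (fun y' => deriv (fun s'' => w s'' y') s) y (EuclideanSpace.single i 1)) *
            fderiv ℝ (w s) y (EuclideanSpace.single i 1) +
          γ (w s y) * deriv (fun s'' => w s'' y) s *
            fderiv ℝ (fun y' => fderiv ℝ (w s) y' (EuclideanSpace.single i 1)) y (EuclideanSpace.single i 1))) =
        0 := Finset.sum_eq_zero fun i _ => by ring
  rw [Finset.sum_add_distrib, Finset.sum_add_distrib, ← Finset.mul_sum, ← Finset.mul_sum] at hsum
  linear_combination hsum

/-- **Local energy inequality for `w_ss = div(γ(w)∇w)`, hypotheses on the truncated solid cone only.**  Let `w` be jointly smooth on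
`ℝ × ℝⁿ` and `γ` smooth.  Assume, ONLY at the points `(s, y)` with `t₀ ≤ s ≤ t` and `‖y‖ ≤ √(1+ρ²) + c(t − s) + 1`: the equation
`∂ₛ∂ₛw = Σᵢ ∂ᵢ(γ(w)∂ᵢw)`, `0 ≤ γ(w) ≤ c²` and `|γ'(w)∂ₛw| ≤ Kγ(w)` (`c, K ≥ 0`).  Then with `e = ½(∂ₛw)² + ½γ(w)|∇w|²`:
`∫_{|y| ≤ ρ} e(t, y) dy ≤ exp(K(t − t₀)) ∫_{|y| ≤ √(1+ρ²) + c(t−t₀) + 1} e(t₀, y) dy`. [folklore] -/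
theorem waveEnergy_closedBall_le_exp_mul_local (hw : ContDiff ℝ ∞ (uncurry w)) (hγ : ContDiff ℝ ∞ γ)
    {c K t₀ t : ℝ} (hc : 0 ≤ c) (hK : 0 ≤ K) (ht : t₀ ≤ t) (ρ : ℝ)
    (hpde : ∀ s ∈ Icc t₀ t, ∀ y : EuclideanSpace ℝ (Fin n), ‖y‖ ≤ √(1 + ρ ^ 2) + c * (t - s) + 1 →
      deriv (fun s' => deriv (fun s'' => w s'' y) s') s =
        ∑ i, fderiv ℝ (fun y' => γ (w s y') * fderiv ℝ (w s) y' (EuclideanSpace.single i 1)) y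
          (EuclideanSpace.single i 1))
    (hγ0 : ∀ s ∈ Icc t₀ t, ∀ y : EuclideanSpace ℝ (Fin n), ‖y‖ ≤ √(1 + ρ ^ 2) + c * (t - s) + 1 → 0 ≤ γ (w s y))
    (hγc : ∀ s ∈ Icc t₀ t, ∀ y : EuclideanSpace ℝ (Fin n), ‖y‖ ≤ √(1 + ρ ^ 2) + c * (t - s) + 1 → γ (w s y) ≤ c ^ 2)
    (hγK : ∀ s ∈ Icc t₀ t, ∀ y : EuclideanSpace ℝ (Fin n), ‖y‖ ≤ √(1 + ρ ^ 2) + c * (t - s) + 1 →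
      |deriv γ (w s y) * deriv (fun s'' => w s'' y) s| ≤ K * γ (w s y)) :
    ∫ y in closedBall (0 : EuclideanSpace ℝ (Fin n)) ρ,
        ((1 / 2) * deriv (fun s'' => w s'' y) t ^ 2 +
          (1 / 2) * γ (w t y) * ∑ i, fderiv ℝ (w t) y (EuclideanSpace.single i 1) ^ 2) ≤
      Real.exp (K * (t - t₀)) *
        ∫ y in closedBall (0 : EuclideanSpace ℝ (Fin n)) (√(1 + ρ ^ 2) + c * (t - t₀) + 1),
          ((1 / 2) * deriv (fun s'' => w s'' y) t₀ ^ 2 +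
            (1 / 2) * γ (w t₀ y) * ∑ i, fderiv ℝ (w t₀) y (EuclideanSpace.single i 1) ^ 2) := by
  refine setIntegral_closedBall_le_exp_mul_local
    (e := fun s y => (1 / 2) * deriv (fun s'' => w s'' y) s ^ 2 +
      (1 / 2) * γ (w s y) * ∑ i, fderiv ℝ (w s) y (EuclideanSpace.single i 1) ^ 2)
    (f := fun i s y => -(γ (w s y) * deriv (fun s'' => w s'' y) s * fderiv ℝ (w s) y (EuclideanSpace.single i 1)))
    (σ := fun s y => (1 / 2) * deriv γ (w s y) * deriv (fun s'' => w s'' y) s *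
      ∑ i, fderiv ℝ (w s) y (EuclideanSpace.single i 1) ^ 2)
    (contDiff_uncurry_energy hw hγ) (contDiff_uncurry_flux hw hγ) (contDiff_uncurry_source hw hγ) ht ρ
    (fun s hs y hy => waveEnergy_balance_at hw hγ (hpde s hs y hy)) ?_ ?_ ?_
  · intro s hs y hy
    have hA0 : 0 ≤ ∑ i, fderiv ℝ (w s) y (EuclideanSpace.single i 1) ^ 2 := Finset.sum_nonneg fun i _ => sq_nonneg _
    nlinarith [sq_nonneg (deriv (fun s'' => w s'' y) s), mul_nonneg (hγ0 s hs y hy) hA0]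
  · intro s hs y hy
    exact waveEnergy_flux_dominated hc s y (hγ0 s hs y hy) (hγc s hs y hy)
  · intro s hs y hy
    exact waveEnergy_source_le s y hK (hγK s hs y hy)

/-- **Domain of dependence for `w_ss = div(γ(w)∇w)`, hypotheses on the truncated solid cone only.**  Under the hypotheses of
`waveEnergy_closedBall_le_exp_mul_local`, if the data at height `t₀` are static (`∂ₛw = 0`, `∇w = 0`) on the ball
`|y| ≤ √(1+ρ²) + c(t − t₀) + 1`, then at height `t` the solution is static on the open ball `|y| < ρ`:
`∂ₛw(t, y) = 0` and `γ(w)|∇w|²(t, y) = 0`.  (In the real-analytic class of the stubs this is superseded by analytic continuation; it is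
recorded for the smooth class.) [folklore] -/
theorem static_of_static_data_local (hw : ContDiff ℝ ∞ (uncurry w)) (hγ : ContDiff ℝ ∞ γ)
    {c K t₀ t : ℝ} (hc : 0 ≤ c) (hK : 0 ≤ K) (ht : t₀ ≤ t) {ρ : ℝ}
    (hpde : ∀ s ∈ Icc t₀ t, ∀ y : EuclideanSpace ℝ (Fin n), ‖y‖ ≤ √(1 + ρ ^ 2) + c * (t - s) + 1 →
      deriv (fun s' => deriv (fun s'' => w s'' y) s') s =
        ∑ i, fderiv ℝ (fun y' => γ (w s y') * fderiv ℝ (w s) y' (EuclideanSpace.single i 1)) y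
          (EuclideanSpace.single i 1))
    (hγ0 : ∀ s ∈ Icc t₀ t, ∀ y : EuclideanSpace ℝ (Fin n), ‖y‖ ≤ √(1 + ρ ^ 2) + c * (t - s) + 1 → 0 ≤ γ (w s y))
    (hγc : ∀ s ∈ Icc t₀ t, ∀ y : EuclideanSpace ℝ (Fin n), ‖y‖ ≤ √(1 + ρ ^ 2) + c * (t - s) + 1 → γ (w s y) ≤ c ^ 2)
    (hγK : ∀ s ∈ Icc t₀ t, ∀ y : EuclideanSpace ℝ (Fin n), ‖y‖ ≤ √(1 + ρ ^ 2) + c * (t - s) + 1 →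
      |deriv γ (w s y) * deriv (fun s'' => w s'' y) s| ≤ K * γ (w s y))
    (hstatic : ∀ y ∈ closedBall (0 : EuclideanSpace ℝ (Fin n)) (√(1 + ρ ^ 2) + c * (t - t₀) + 1),
      deriv (fun s'' => w s'' y) t₀ = 0 ∧ ∀ i, fderiv ℝ (w t₀) y (EuclideanSpace.single i 1) = 0)
    {y : EuclideanSpace ℝ (Fin n)} (hy : y ∈ ball (0 : EuclideanSpace ℝ (Fin n)) ρ) :
    deriv (fun s'' => w s'' y) t = 0 ∧
      γ (w t y) * ∑ i, fderiv ℝ (w t) y (EuclideanSpace.single i 1) ^ 2 = 0 := by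
  have hle := waveEnergy_closedBall_le_exp_mul_local hw hγ hc hK ht ρ hpde hγ0 hγc hγK
  -- the data energy vanishes on the big ball
  have hdata : ∫ y in closedBall (0 : EuclideanSpace ℝ (Fin n)) (√(1 + ρ ^ 2) + c * (t - t₀) + 1),
      ((1 / 2) * deriv (fun s'' => w s'' y) t₀ ^ 2 +
        (1 / 2) * γ (w t₀ y) * ∑ i, fderiv ℝ (w t₀) y (EuclideanSpace.single i 1) ^ 2) = 0 := by
    refine setIntegral_eq_zero_of_forall_eq_zero fun y hy' => ?_
    obtain ⟨h1, h2⟩ := hstatic y hy'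
    simp [h1, h2]
  rw [hdata, mul_zero] at hle
  -- the energy at height `t` is continuous, nonnegative on the closed ball `|y| ≤ ρ`, with zero integral there
  have hρ : 0 < ρ := by
    have := mem_ball.1 hy
    rw [dist_zero_right] at this
    linarith [norm_nonneg y]
  have hcont : Continuous fun y : EuclideanSpace ℝ (Fin n) => (1 / 2) * deriv (fun s'' => w s'' y) t ^ 2 +
      (1 / 2) * γ (w t y) * ∑ i, fderiv ℝ (w t) y (EuclideanSpace.single i 1) ^ 2 :=
    (contDiff_slice (contDiff_uncurry_energy hw hγ) t).continuous
  -- nonnegativity on the closed ball of radius `ρ` (inside the cone region at height `t`)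
  have hreg : ∀ y' ∈ closedBall (0 : EuclideanSpace ℝ (Fin n)) ρ, ‖y'‖ ≤ √(1 + ρ ^ 2) + c * (t - t) + 1 := by
    intro y' hy'
    rw [mem_closedBall, dist_zero_right] at hy'
    have h1 : ρ ≤ √(1 + ρ ^ 2) := by
      have h := Real.sqrt_le_sqrt (show ρ ^ 2 ≤ 1 + ρ ^ 2 by linarith)
      rwa [Real.sqrt_sq hρ.le] at h
    nlinarith
  have hnn : ∀ y' ∈ closedBall (0 : EuclideanSpace ℝ (Fin n)) ρ, 0 ≤ (1 / 2) * deriv (fun s'' => w s'' y') t ^ 2 +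
      (1 / 2) * γ (w t y') * ∑ i, fderiv ℝ (w t) y' (EuclideanSpace.single i 1) ^ 2 := by
    intro y' hy'
    have hA0 : 0 ≤ ∑ i, fderiv ℝ (w t) y' (EuclideanSpace.single i 1) ^ 2 := Finset.sum_nonneg fun i _ => sq_nonneg _
    nlinarith [sq_nonneg (deriv (fun s'' => w s'' y') t), mul_nonneg (hγ0 t (right_mem_Icc.2 ht) y' (hreg y' hy')) hA0]
  have hint0 : ∫ y in closedBall (0 : EuclideanSpace ℝ (Fin n)) ρ,
      ((1 / 2) * deriv (fun s'' => w s'' y) t ^ 2 +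
        (1 / 2) * γ (w t y) * ∑ i, fderiv ℝ (w t) y (EuclideanSpace.single i 1) ^ 2) = 0 :=
    le_antisymm hle (setIntegral_nonneg measurableSet_closedBall fun y hy' => hnn y hy')
  -- a continuous function, nonnegative on the closed ball with zero integral there, vanishes on the open ball
  have hzero : (1 / 2) * deriv (fun s'' => w s'' y) t ^ 2 +
      (1 / 2) * γ (w t y) * ∑ i, fderiv ℝ (w t) y (EuclideanSpace.single i 1) ^ 2 = 0 := by
    by_contra hne
    set g : EuclideanSpace ℝ (Fin n) → ℝ := fun y => (1 / 2) * deriv (fun s'' => w s'' y) t ^ 2 +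
      (1 / 2) * γ (w t y) * ∑ i, fderiv ℝ (w t) y (EuclideanSpace.single i 1) ^ 2 with hg
    have hgy : 0 < g y := lt_of_le_of_ne (hnn y (ball_subset_closedBall hy)) (Ne.symm hne)
    have hI : IntegrableOn g (closedBall (0 : EuclideanSpace ℝ (Fin n)) ρ) :=
      hcont.continuousOn.integrableOn_compact (isCompact_closedBall _ _)
    -- `g > 0` on an open neighbourhood of `y` inside the ball
    have hopen : IsOpen ({y' | 0 < g y'} ∩ ball (0 : EuclideanSpace ℝ (Fin n)) ρ) :=
      (isOpen_lt continuous_const hcont).inter isOpen_ball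
    have hmem : y ∈ {y' | 0 < g y'} ∩ ball (0 : EuclideanSpace ℝ (Fin n)) ρ := ⟨hgy, hy⟩
    have hpos : 0 < volume ({y' | 0 < g y'} ∩ ball (0 : EuclideanSpace ℝ (Fin n)) ρ) :=
      hopen.measure_pos volume ⟨y, hmem⟩
    have hsub : {y' | 0 < g y'} ∩ ball (0 : EuclideanSpace ℝ (Fin n)) ρ ⊆
        Function.support g ∩ closedBall (0 : EuclideanSpace ℝ (Fin n)) ρ :=
      fun y' hy' => ⟨hy'.1.ne', ball_subset_closedBall hy'.2⟩
    have hpos' : 0 < volume (Function.support g ∩ closedBall (0 : EuclideanSpace ℝ (Fin n)) ρ) :=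
      hpos.trans_le (measure_mono hsub)
    have hint' : 0 < ∫ y in closedBall (0 : EuclideanSpace ℝ (Fin n)) ρ, g y :=
      (setIntegral_pos_iff_support_of_nonneg_ae
        ((ae_restrict_iff' measurableSet_closedBall).2 (Eventually.of_forall fun y' hy' => hnn y' hy')) hI).2 hpos'
    exact absurd hint0 (ne_of_gt hint')
  have hA0 : 0 ≤ ∑ i, fderiv ℝ (w t) y (EuclideanSpace.single i 1) ^ 2 := Finset.sum_nonneg fun i _ => sq_nonneg _
  have h1 : 0 ≤ (1 / 2) * deriv (fun s'' => w s'' y) t ^ 2 := by positivity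
  have h2 : 0 ≤ (1 / 2) * γ (w t y) * ∑ i, fderiv ℝ (w t) y (EuclideanSpace.single i 1) ^ 2 :=
    mul_nonneg (mul_nonneg (by norm_num) (hγ0 t (right_mem_Icc.2 ht) y (hreg y (ball_subset_closedBall hy)))) hA0
  constructor
  · nlinarith [sq_nonneg (deriv (fun s'' => w s'' y) t)]
  · nlinarith

end Wave

end Summit.NavierStokesRegularity.NavierStokesRegularity.Theorems.PoloidalWindowDoorPoloidalWindowRigidityZShockWaveLocalEnergyLocal

end
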